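import Literature.Barriers.Parity.SiegelZeroDichotomy
import Mathlib.NumberTheory.NumberField.ClassNumber
import HarnessLib

/-!
# The greatest real zero of a real `L`-function by elementary methods (Pintz 1976, part II):
# `L'(1) ∼ L(1)/δ ∼ Σ_{n ≤ D²} g(n)/n`, the Siegel zero of a field with tiny class number,
# `δ ≥ (12 − o(1))/(π√D)`, and the `Σ (1 + χ(p))/p` dictionary — AS PRINTED

Topic `Literature/NumberTheory/LFunctions` (namespace `Literature.NumberTheory.LFunctions`; the
paper's auxiliary objects in the sub-namespace `Pintz1976`). STATEMENT LAYER (D-0014) typed for the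
cell `parity-realchar` (SIEGEL INSTRUMENT, conditionals column «illusory world», topics I.1 «class
numbers» and the `1 − β ≥ c/√d` comparator line of TARGET §2 row 14: "Goldfeld–Schinzel `6/π`, Pintz
`12/π`, `16/π` were asymptotic") and cc `landau-siegel` (§C, exceptional characters). Source:
J. Pintz, *Elementary methods in the theory of L-functions, II. On the greatest real zero of a real
L-function*, Acta Arith. **31** (1976) 273–289 [Pintz1976ElementaryII] — the journal scan
(`matwbn.icm.edu.pl/ksiazki/aa/aa31/aa3139.pdf`, corpus key `paper:url-0b1ad9125237`; the IMPAN
text layer `paper:doi-10-4064-aa-31-3-273-289` is empty) was rendered page by page and READ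
(pp. 273–289); every statement below is quoted from the page named in its docstring. "All the
results of this paper will be effective" (p. 275).

## Setting and how it is typed

p. 279 §2: "`χ` will denote a real non-principal character modulo `D`, `L(s)` the corresponding
`L`-series, `g(n) = Σ_{d ∣ n} χ(d)`." p. 274: "The real zeros `1 − δ` with `δ ≤ 1/log D` we shall
call Siegel-zeros." Theorems 2–3 speak of "the greatest real zero `1 − δ` of `L(s, χ)`".

* Characters: `χ : DirichletCharacter ℂ D` with Mathlib's `MulChar.IsQuadratic` ("real") and
  `IsPrimitive`. The paper states Theorems 1, 4, 5 and Lemmas 1, 3 for real NON-PRINCIPAL `χ`; they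
  are typed here for PRIMITIVE real `χ` (a special case — weaker than print, the safe direction):
  the proofs of Lemma 3 / Theorems 4–5 use "`√D · L(1) ≥ π`" (p. 287, (5.4)), which the paper
  justifies in (1.2) for "a real primitive character modulo `D`" only, and the column's consumers
  only ever meet primitive quadratic characters. `-- TODO(general form): imprimitive real χ.`
* `L(1)`, `L'(1)` are real for real `χ`: rendered as `(χ.LFunction 1).re`, `(deriv χ.LFunction 1).re`.
* "`∼`" / "`o(1)`" / "`≪`" with effective constants are rendered by explicit quantifiers:
  `A ∼ B` under a hypothesis "`X = o(Y)`" becomes "for every `ε > 0` there are `η > 0` and `D₀`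
  such that `X ≤ η Y` and `D ≥ D₀` imply `|A/B − 1| ≤ ε`"; "`≪`" becomes "`≤ C ·`" with one
  absolute `C` beyond a threshold `D₀` (thresholds only weaken the typed statement).
* "the greatest real zero `1 − δ`": `Pintz1976.IsGreatestRealZero χ β` (`β < 1`, `L(β, χ) = 0`, no
  real zero in `(β, 1)`); "the Siegel-zero (which exists by the theorem of Hecke [11])" in
  Theorems 1 and 5: the existence of a real zero `β` with `1 − β ≤ 1/log D` is part of the typed
  conclusion, and the asymptotic relations are asserted for the greatest real zero.
* `h(−D)` (Theorem 2): the class number of `ℚ(√−D)`, rendered over an imaginary quadratic field `K`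
  (`[K:ℚ] = 2`, `d_K < 0`, `D = |d_K|`, `h(−D) = NumberField.classNumber K`) with `χ` THE odd
  primitive quadratic character mod `|d_K|` (= the Kronecker character `(d_K/·)`; tree dictionary
  `PrimitiveQuadratic.apply_natCast_eq_jacobiSym_neg_of_odd`, `exists_kroneckerChar`) — the pattern
  of `ralaivaosaonaRazakarinoro2026_theorem2`.

## Contents (named facts = `def … : Prop`, unproved here; cite tags carry page and display numbers)

* `Pintz1976.g`, `Pintz1976.gSum` (`Σ_{n ≤ x} g(n)/n`), `Pintz1976.IsGreatestRealZero` — defs.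
* `pintz1976_lemma1` — Lemma 1 (p. 279, (2.1)): explicit `Σ_{n≤x} g(n)/n = L'(1) + (log x + γ)L(1)
  + 5ϑ √(√D log D log x / x)`, `|ϑ| ≤ 1`, `x ≥ 4√D log²D`. PROVED AS PRINTED (2026-08-30):
  `pintz1976_lemma1_holds` in `GreatestRealZeroElementaryLemmaOneProofs.lean`.
* `pintz1976_lemma3` — Lemma 3 (p. 286, (5.1)–(5.2)): explicit `L(1) > (5 log D)⁻¹
  (α log A/(8 log D))^{8 log D/log A}`, `α = Σ_{A < p ≤ D², χ(p) ≠ −1} 1/p`, `D ≥ 1500`.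
* `pintz1976_theorem1` — Theorem 1 (p. 275, (1.16)–(1.17)).
* `pintz1976_theorem2` — Theorem 2 (p. 276, (1.21)–(1.23)): `h(−D) ≤ log D/(2 log log D)` ⟹
  `δ ∼ 6h(−D)/(π ∏_{p∣D}(1 + 1/p) √D)` — the explicit «Siegel zero ⟺ tiny class number» dictionary.
* `pintz1976_theorem3` — Theorem 3 (p. 277, (1.24)): `δ ≥ (12 − o(1))/(π√D)` for real primitive `χ`;
  `pintz1976_theorem3_schinzel` — footnote (2) p. 277 (Schinzel, as referee): `δ > (16/π − ε)/√D`
  for `D > D₀(ε)`.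
* `pintz1976_theorem4` — Theorem 4 (pp. 277–278, (1.25)–(1.26)); `pintz1976_theorem5` — Theorem 5
  (pp. 278–279, (1.30)–(1.31)).
* PROVED glue: `Pintz1976.theorem3_of_schinzel` (footnote ⟹ Theorem 3),
  `Pintz1976.realZero_le_of_theorem3` (every real zero obeys the bound, not only the greatest; via a
  private `exists_isGreatestRealZero`: a real zero `< 1` forces a greatest one),
  `Pintz1976.IsSiegelZero.quality_le_of_theorem3` (Tao–Teräväinen quality `η ≤ √D/((12/π − ε) log D)`
  for `D ≥ D₀(ε)`).

Index only (not typed): Theorem (Haneke) p. 278 (1.27)–(1.29) (Haneke's theorem restated with a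
corrected exponent — Haneke's, not Pintz's, result; constant `c₂` unspecified); Lemma 2 (p. 281,
with an unspecified `c_τ ∈ (0,1)`); the error-term refinement of Theorem 2 printed on p. 284
("`δ = 6h(−D)/(π∏(1+1/p)√D) {1 + O(h(−D) exp(log D/(2h(−D)+2)))}`" — the exponent's sign is
illegible/misprinted on the scan relative to (3.3)–(3.4), so it is not vendored); the historical
survey (1.1)–(1.15) (Page, Siegel, Davenport, Haneke, Rosser).

LABEL (cell rule): instrument / statement layer. WHAT THIS IS NOT: no claim that any Siegel zero or
any field with `h(−D) ≤ log D/(2 log log D)` exists (by Goldfeld–Gross–Zagier–Oesterlé there are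
none beyond an effective bound — the hypothesis of Theorem 2 is a genuinely «illusory» one); nothing
here bears on parity. No instances, no notation, no axioms.

## References

* [Pintz1976ElementaryII] J. Pintz, Acta Arith. 31 (1976) 273–289: Theorem 1 p. 275; Theorems 2–4
  pp. 276–278; Theorem 5 pp. 278–279; Lemma 1 p. 279; Lemma 2 p. 281; Lemma 3 p. 286; footnote (2)
  p. 277 (Schinzel).
* [GoldfeldSchinzel1975] D. M. Goldfeld, A. Schinzel, *On Siegel's zero*, Ann. SNS Pisa (4) 2 (1975)
  571–583 — the `6/π` predecessor of Theorem 3 (typed in `SiegelZeroFormSumAsymptotic.lean`).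
* [TaoTeravainen2021] Definition 1.4 (`IsSiegelZero`, glue only).
-/

noncomputable section

open Complex Finset

namespace Literature.NumberTheory.LFunctions

namespace Pintz1976

/-- `g(n) = Σ_{d ∣ n} χ(d)` (p. 275 / p. 279), as a real number (the character is real-valued).
[cite: Pintz1976ElementaryII, §1 (1.17) and §2 p. 279] -/
def g {D : ℕ} [NeZero D] (χ : DirichletCharacter ℂ D) (n : ℕ) : ℝ :=
  (∑ d ∈ n.divisors, χ (d : ZMod D)).re

/-- `Σ_{n ≤ x} g(n)/n` (the sum of (1.17), (2.1), (2.3)).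
[cite: Pintz1976ElementaryII, §1 (1.17) and Lemma 1 (2.1)] -/
def gSum {D : ℕ} [NeZero D] (χ : DirichletCharacter ℂ D) (x : ℝ) : ℝ :=
  ∑ n ∈ Icc 1 ⌊x⌋₊, g χ n / (n : ℝ)

/-- "The greatest real zero `1 − δ` of `L(s, χ)`" (Theorems 2, 3): `β < 1` is a real zero of
`L(s, χ)` and there is no real zero in `(β, 1)`.
[cite: Pintz1976ElementaryII, Theorem 2 p. 276 ("the greatest real zero")] -/
def IsGreatestRealZero {D : ℕ} [NeZero D] (χ : DirichletCharacter ℂ D) (β : ℝ) : Prop :=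
  β < 1 ∧ χ.LFunction (β : ℂ) = 0 ∧ ∀ β' : ℝ, β < β' → β' < 1 → χ.LFunction (β' : ℂ) ≠ 0

/-- The greatest real zero is a zero. [cite: Pintz1976ElementaryII, Theorem 2 p. 276] -/
theorem IsGreatestRealZero.lfunction_eq_zero {D : ℕ} [NeZero D] {χ : DirichletCharacter ℂ D}
    {β : ℝ} (h : IsGreatestRealZero χ β) : χ.LFunction (β : ℂ) = 0 := h.2.1

/-- The greatest real zero is `< 1`. [cite: Pintz1976ElementaryII, Theorem 2 p. 276] -/
theorem IsGreatestRealZero.lt_one {D : ℕ} [NeZero D] {χ : DirichletCharacter ℂ D}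
    {β : ℝ} (h : IsGreatestRealZero χ β) : β < 1 := h.1

/-- Two greatest real zeros coincide. [cite: Pintz1976ElementaryII, Theorem 2 p. 276] -/
theorem IsGreatestRealZero.unique {D : ℕ} [NeZero D] {χ : DirichletCharacter ℂ D}
    {β β' : ℝ} (h : IsGreatestRealZero χ β) (h' : IsGreatestRealZero χ β') : β = β' := by
  by_contra hne
  rcases lt_or_gt_of_ne hne with hlt | hlt
  · exact h.2.2 β' hlt h'.1 h'.2.1
  · exact h'.2.2 β hlt h.1 h.2.1

end Pintz1976

open Pintz1976

/-! ### The explicit lemmas -/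

/-- **Pintz 1976 (II), Lemma 1 (NAMED FACT, as printed, p. 279 (2.1)).** "For an arbitrary
`x ≥ 4√D log²D`: `Σ_{n ≤ x} g(n)/n = L'(1) + (log x + c) L(1) + 5ϑ √(√D log D log x / x)`, where
`c` denotes Euler's constant, `ϑ` denotes a real number with an absolute value not exceeding `1`."
Rendered as the two-sided inequality `|Σ_{n≤x} g(n)/n − L'(1) − (log x + γ) L(1)| ≤ 5 √(√D log D
log x/x)`. Printed for every real non-principal `χ` mod `D` (proof: Pólya's inequality
`|Σ_a^b χ(d)| ≤ (5/3)√D log D` and Abel summation, pp. 279–280); typed for primitive real `χ`.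
PROVED (2026-08-30): `pintz1976_lemma1_holds` (`GreatestRealZeroElementaryLemmaOneProofs.lean`) — the
same three Abel summations run with an INTERVAL character-sum bound `P` (`|Σ_{a<d≤b} χ(d)| ≤ P`, cost
`P·f(Y+1)` per monotone weight), the exact cancellation of the `log(Y+1)` parts of the `log d/d`-tail
and of `Σ₂`, the harmonic remainder `2d/x` (`DirichletConvOneChiSumSharp.lean`:
`‖Σ_{n≤x} g(n)/n − ((log x + γ)L(1) + L'(1))‖ ≤ P(2 log x + γ + 1)/(Y+1) + 2Y/x`, `2 ≤ Y ≤ x`), and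
`P = D/2` for `D ≤ 69`, Pomerance's `1/π`-Pólya–Vinogradov bound for `D ≥ 70`; this delivers the printed
constant `5` (the READING NOTE below explains why the printed bookkeeping does not).

READING NOTE (typing seat, 2026-08-27; the statement above is unchanged and AS PRINTED). The printed
proof does not deliver the printed constant `5`: p. 280 bounds the four error terms, at the choice
`z = √(√D log D log x · x)`, by `(5/3)√D log D (log x + c)/z`, `(5/3)√D log D log z/z`,
`(5/3)√D log D log x/z` and `z/x`; writing `E = √(√D log D log x/x)` one has `√D log D/z = E/log x`
and `z/x = E`, so their sum is `E · [(5/3)(2 + (c + log z)/log x) + 1]`, which lies in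
`[5.16 E, (6 + 5c/(3 log x)) E]` because `½ log x ≤ log z ≤ log x` in the printed range — never
`≤ 5E`. The constant `5` is therefore not supported by the displayed steps (with Pólya's constant
`5/3`); the statement itself is not known to be false (sharper Pólya–Vinogradov constants leave room
for large `D`). A discharge AS PRINTED should not follow p. 280 verbatim (and the one above does not:
it sharpens exactly the `P log z/z` + `Σ₂` accounting). Consumers that only need
an explicit `O(√(B log x/x))` form with a PROVED constant should use the tree's
`Literature.NumberTheory.LFunctions.DirichletAbel.norm_sum_divisorSum_div_sub_le` /
`…_polyaVinogradov` (`DirichletConvOneChiSum.lean`: `|Σ_{n≤N} r(n)/n − ((log N + γ)L(1,χ) + L'(1,χ))|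
≤ 8B(log N + 1)/(Y + 1) + 4Y/N`, `2 ≤ Y ≤ N`), which is Montgomery–Vaughan Exercise 11.2.3(g); all
uses of Lemma 1 in part II (Theorem 1, (2.3)) are of the `o(1)` form and do not depend on the value
of the constant. [cite: Pintz1976ElementaryII, Lemma 1 p. 279 (2.1); proof p. 280]
[cite: MontgomeryVaughan2007, §11.2.1 Exercise 3(g)] -/
def pintz1976_lemma1 : Prop :=
  ∀ (D : ℕ) [NeZero D] (χ : DirichletCharacter ℂ D), χ.IsQuadratic → χ.IsPrimitive → χ ≠ 1 →
    ∀ x : ℝ, 4 * Real.sqrt D * Real.log D ^ 2 ≤ x →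
      |gSum χ x - (deriv χ.LFunction 1).re -
          (Real.log x + Real.eulerMascheroniConstant) * (χ.LFunction 1).re| ≤
        5 * Real.sqrt (Real.sqrt D * Real.log D * Real.log x / x)

/-- **Pintz 1976 (II), Lemma 3 (NAMED FACT, as printed, p. 286 (5.1)–(5.2)).** "For a non-principal
real character `χ (mod D)` (`≥ 1500`) for any `A`, `2 ≤ A ≤ D²`, and with the notation
`Σ_{A < p ≤ D², χ(p) ≠ −1} 1/p = α` the inequality `L(1) > (1/(5 log D)) (α log A/(8 log D))^{8 log D/log A}`
holds." (Real power of the non-negative base `α log A/(8 log D)`.) Typed for primitive real `χ`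
(the proof's input `√D·L(1) ≥ π`, p. 287, is the primitive case (1.2)). Unproved here.
[cite: Pintz1976ElementaryII, Lemma 3 p. 286 (5.1)–(5.2)] -/
def pintz1976_lemma3 : Prop :=
  ∀ (D : ℕ) [NeZero D] (χ : DirichletCharacter ℂ D), χ.IsQuadratic → χ.IsPrimitive → χ ≠ 1 →
    1500 ≤ D → ∀ A : ℝ, 2 ≤ A → A ≤ (D : ℝ) ^ 2 →
      (1 / (5 * Real.log D)) *
          ((∑ p ∈ (range (D ^ 2 + 1)).filter
                (fun p : ℕ => p.Prime ∧ A < (p : ℝ) ∧ χ (p : ZMod D) ≠ -1),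
              (1 : ℝ) / (p : ℝ)) * Real.log A / (8 * Real.log D)) ^ (8 * Real.log D / Real.log A) <
        (χ.LFunction 1).re

/-! ### Theorem 1: `L'(1) ∼ L(1)/δ ∼ Σ_{n ≤ D²} g(n)/n` -/

/-- **Pintz 1976 (II), Theorem 1 (NAMED FACT, as printed, p. 275 (1.16)–(1.17)).** "Let `χ` be a
real non-principal character modulo `D`, for which `L(1) = o(1/log D)` (1.16). Then for the
Siegel-zero `1 − δ` of `L(s)` (which exists by the theorem of Hecke [11]) with the notation
`g(n) = Σ_{d∣n} χ(d)`: `L'(1) ∼ L(1)/δ ∼ Σ_{n ≤ D²} g(n)/n ≥ ∏_{p∣D} (1 + 1/p)(π²/6 − o(1))` (1.17)."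
("The sign `∼` replaces a factor `1 + o(1)`", p. 276; effective.) Rendered: for every `ε > 0` there
are `η > 0` and `D₀` such that for `D ≥ D₀`, every primitive real `χ` mod `D` with
`L(1) log D ≤ η` has a real zero `β` with `1 − β ≤ 1/log D` (a Siegel-zero in the paper's sense,
p. 274), and for the greatest real zero `β = 1 − δ`: `|δ L'(1)/L(1) − 1| ≤ ε`,
`|(L(1)/δ)/Σ_{n≤D²} g(n)/n − 1| ≤ ε` and `Σ_{n≤D²} g(n)/n ≥ ∏_{p∣D}(1 + 1/p)(π²/6 − ε)`. Typed for
primitive `χ` (printed: non-principal). Unproved here (§2: Lemmas 1–2, (2.3)–(2.12)).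
[cite: Pintz1976ElementaryII, Theorem 1 p. 275 (1.16)–(1.17)] -/
def pintz1976_theorem1 : Prop :=
  ∀ ε : ℝ, 0 < ε → ∃ η : ℝ, 0 < η ∧ ∃ D₀ : ℕ, ∀ (D : ℕ) [NeZero D], D₀ ≤ D →
    ∀ χ : DirichletCharacter ℂ D, χ.IsQuadratic → χ.IsPrimitive →
      (χ.LFunction 1).re * Real.log D ≤ η →
        (∃ β : ℝ, 1 - 1 / Real.log D ≤ β ∧ β < 1 ∧ χ.LFunction (β : ℂ) = 0) ∧
        ∀ β : ℝ, IsGreatestRealZero χ β →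
          |(1 - β) * (deriv χ.LFunction 1).re / (χ.LFunction 1).re - 1| ≤ ε ∧
          |(χ.LFunction 1).re / (1 - β) / gSum χ ((D : ℝ) ^ 2) - 1| ≤ ε ∧
          (∏ p ∈ D.primeFactors, (1 + 1 / (p : ℝ))) * (Real.pi ^ 2 / 6 - ε) ≤ gSum χ ((D : ℝ) ^ 2)

/-! ### Theorem 2: the Siegel zero of a field with class number `≤ log D/(2 log log D)` -/

/-- **Pintz 1976 (II), Theorem 2 (NAMED FACT, as printed, p. 276 (1.21)–(1.23)).** "If `−D < 0` is a
fundamental discriminant for which the inequality `h(−D) ≤ log D/(2 log log D)` (1.21) holds, then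
for the greatest real zero `1 − δ` of `L(s, χ)`, where `χ(n) = (−D/n)`, the relation
`L(1)/δ ∼ (π²/6) ∏_{p∣D} (1 + 1/p)` (1.22), i.e.
`δ ∼ 6L(1)/(π² ∏_{p∣D}(1 + 1/p)) = 6h(−D)/(π ∏_{p∣D}(1 + 1/p) √D)` (1.23) holds." Effective
(p. 275). Rendered with `ε`/`D₀` for `∼`, over imaginary quadratic fields `K` (`d_K = −D`,
`h(−D) = h_K`) and the odd primitive quadratic character mod `|d_K|` (= `(−D/·)`), for the greatest
real zero `β = 1 − δ` (no existence asserted here). Unproved here (§3).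
[cite: Pintz1976ElementaryII, Theorem 2 p. 276 (1.21)–(1.23)] -/
def pintz1976_theorem2 : Prop :=
  ∀ ε : ℝ, 0 < ε → ∃ D₀ : ℕ, ∀ (K : Type) [Field K] [NumberField K]
    [NeZero (NumberField.discr K).natAbs], Module.finrank ℚ K = 2 → NumberField.discr K < 0 →
    D₀ ≤ (NumberField.discr K).natAbs →
    (NumberField.classNumber K : ℝ) ≤
        Real.log (NumberField.discr K).natAbs /
          (2 * Real.log (Real.log (NumberField.discr K).natAbs)) →
    ∀ χ : DirichletCharacter ℂ (NumberField.discr K).natAbs,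
      χ.IsQuadratic → χ.IsPrimitive → χ.Odd →
      ∀ β : ℝ, IsGreatestRealZero χ β →
        |(χ.LFunction 1).re / (1 - β) /
              (Real.pi ^ 2 / 6 * ∏ p ∈ (NumberField.discr K).natAbs.primeFactors, (1 + 1 / (p : ℝ))) -
            1| ≤ ε ∧
        |(1 - β) /
              (6 * (NumberField.classNumber K : ℝ) /
                (Real.pi * (∏ p ∈ (NumberField.discr K).natAbs.primeFactors, (1 + 1 / (p : ℝ))) *
                  Real.sqrt (NumberField.discr K).natAbs)) -
            1| ≤ ε

/-! ### Theorem 3: `δ ≥ (12 − o(1))/(π √D)`; Schinzel's footnote `16/π` -/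

/-- **Pintz 1976 (II), Theorem 3 (NAMED FACT, as printed, p. 277 (1.24)).** "For the greatest real
zero `1 − δ` of an `L`-function belonging to a real primitive character modulo `D`, the inequality
`δ ≥ (12 − o(1))/(π√D)` holds." (Effective; "Theorem 3 remains true for imprimitive characters
too", p. 277.) Rendered: for every `ε > 0` there is `D₀` such that for `D ≥ D₀`, every primitive
real `χ` mod `D` and every greatest real zero `β`: `(12/π − ε)/√D ≤ 1 − β`. Unproved here (§4, via
Theorem 2, Theorem 5 and the class-number-`≥ 3` theorem of Baker–Stark).
[cite: Pintz1976ElementaryII, Theorem 3 p. 277 (1.24)] -/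
def pintz1976_theorem3 : Prop :=
  ∀ ε : ℝ, 0 < ε → ∃ D₀ : ℕ, ∀ (D : ℕ) [NeZero D], D₀ ≤ D →
    ∀ χ : DirichletCharacter ℂ D, χ.IsQuadratic → χ.IsPrimitive →
      ∀ β : ℝ, IsGreatestRealZero χ β → (12 / Real.pi - ε) / Real.sqrt D ≤ 1 - β

/-- **Pintz 1976 (II), footnote (2) p. 277 (Schinzel, as referee; NAMED FACT, as printed).**
"Theorem 3 is true in the following sharper form: For the greatest real zero `1 − δ` of an
`L`-function belonging to a real (primitive) character modulo `D`, `δ > (16/π − ε)(1/√D)` if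
`D > D₀(ε)` where `D₀(ε)` is effectively computable." (Proof indication in the footnote: Theorem 2's
argument except for `−D ∈ {−4pq, −8pq, −15r, −21r}` with `h(−D) = 4`, handled by Baker–Schinzel,
Acta Arith. 18 (1971).) Unproved here. [cite: Pintz1976ElementaryII, footnote (2) p. 277] -/
def pintz1976_theorem3_schinzel : Prop :=
  ∀ ε : ℝ, 0 < ε → ∃ D₀ : ℕ, ∀ (D : ℕ) [NeZero D], D₀ < D →
    ∀ χ : DirichletCharacter ℂ D, χ.IsQuadratic → χ.IsPrimitive →
      ∀ β : ℝ, IsGreatestRealZero χ β → (16 / Real.pi - ε) / Real.sqrt D < 1 - β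

/-! ### Theorems 4 and 5: `L(1) ≤ 1/log²D` forces `χ(p) = −1` for most `p ≤ D²` -/

/-- **Pintz 1976 (II), Theorem 4 (NAMED FACT, as printed, pp. 277–278 (1.25)–(1.26)).** "If for the
real non-principal character `χ (mod D)` `L(1, χ) ≤ 1/log²D` (1.25) then
`exp(Σ_{p ≤ D²} (1 + χ(p))/p) ≪ (log D log log D / log(1/(5L(1,χ) log D)))²` (1.26)." ("The theorem
asserts that any upper bound for `L(1, χ)` which is sharper than (1.25) implies a non-trivial upper
bound for `Σ_{p≤D²}(1+χ(p))/p`, i.e. shows that for the most primes `p ≤ D²`, `χ(p) = −1`.")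
Effective `≪` rendered as `≤ C ·` beyond a threshold `D₀`; typed for primitive `χ`. Unproved here
(§5, Lemma 3). [cite: Pintz1976ElementaryII, Theorem 4 pp. 277–278 (1.25)–(1.26)] -/
def pintz1976_theorem4 : Prop :=
  ∃ C : ℝ, ∃ D₀ : ℕ, ∀ (D : ℕ) [NeZero D], D₀ ≤ D →
    ∀ χ : DirichletCharacter ℂ D, χ.IsQuadratic → χ.IsPrimitive →
      (χ.LFunction 1).re ≤ 1 / Real.log D ^ 2 →
        Real.exp (∑ p ∈ (range (D ^ 2 + 1)).filter Nat.Prime, (1 + (χ (p : ZMod D)).re) / p) ≤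
          C * (Real.log D * Real.log (Real.log D) /
                Real.log (1 / (5 * (χ.LFunction 1).re * Real.log D))) ^ 2

/-- **Pintz 1976 (II), Theorem 5 (NAMED FACT, as printed, pp. 278–279 (1.30)–(1.31)).** "If for the
real non-principal character `χ (mod D)` `L(1, χ) ≤ 1/log²D` (1.30), then for the Siegel-zero
`1 − δ` of `L(s)` (which exists by the theorem of Hecke [11])
`L(1)/δ ≪ (log D log log D / log(1/(5L(1) log D)))²` (1.31)." ("any sharper upper bound for
`L(1, χ)` than (1.30) implies an improvement of Page's result (1.4)", p. 279.) Rendered with an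
absolute `C` and a threshold `D₀`: existence of a real zero `β` with `1 − β ≤ 1/log D`, and the
bound for the greatest real zero; typed for primitive `χ`. Unproved here (§6).
[cite: Pintz1976ElementaryII, Theorem 5 pp. 278–279 (1.30)–(1.31)] -/
def pintz1976_theorem5 : Prop :=
  ∃ C : ℝ, ∃ D₀ : ℕ, ∀ (D : ℕ) [NeZero D], D₀ ≤ D →
    ∀ χ : DirichletCharacter ℂ D, χ.IsQuadratic → χ.IsPrimitive →
      (χ.LFunction 1).re ≤ 1 / Real.log D ^ 2 →
        (∃ β : ℝ, 1 - 1 / Real.log D ≤ β ∧ β < 1 ∧ χ.LFunction (β : ℂ) = 0) ∧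
        ∀ β : ℝ, IsGreatestRealZero χ β →
          (χ.LFunction 1).re / (1 - β) ≤
            C * (Real.log D * Real.log (Real.log D) /
                  Real.log (1 / (5 * (χ.LFunction 1).re * Real.log D))) ^ 2

/-! ### PROVED glue -/

namespace Pintz1976

/-- Schinzel's footnote implies Theorem 3 as typed (`16/π − ε > 12/π − ε`, threshold shifted by
one). [cite: Pintz1976ElementaryII, footnote (2) p. 277] -/
theorem theorem3_of_schinzel (h : pintz1976_theorem3_schinzel) : pintz1976_theorem3 := by
  intro ε hε
  obtain ⟨D₀, hD₀⟩ := h ε hε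
  refine ⟨D₀ + 1, fun D _ hD χ hquad hprim β hβ => ?_⟩
  have hlt := hD₀ D (by omega) χ hquad hprim β hβ
  have hsqrt : 0 ≤ Real.sqrt D := Real.sqrt_nonneg _
  have hmono : (12 / Real.pi - ε) / Real.sqrt D ≤ (16 / Real.pi - ε) / Real.sqrt D := by
    apply div_le_div_of_nonneg_right _ hsqrt
    have : 12 / Real.pi ≤ 16 / Real.pi :=
      div_le_div_of_nonneg_right (by norm_num) Real.pi_pos.le
    linarith
  exact le_trans hmono hlt.le

/-- If `L(s, χ)` has a real zero `β₀ < 1`, it has a greatest one (the real zeros in `[β₀, 1]` form a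
compact set on which `L` is continuous and `L(1, χ) ≠ 0`). Private helper. [folklore] -/
private theorem exists_isGreatestRealZero {D : ℕ} [NeZero D] {χ : DirichletCharacter ℂ D} (hχ : χ ≠ 1)
    {β₀ : ℝ} (hβ₀ : β₀ < 1) (hz : χ.LFunction (β₀ : ℂ) = 0) :
    ∃ β : ℝ, β₀ ≤ β ∧ IsGreatestRealZero χ β := by
  classical
  -- the zero set on `[β₀, 1]`
  set Z : Set ℝ := {t : ℝ | t ∈ Set.Icc β₀ 1 ∧ χ.LFunction (t : ℂ) = 0} with hZ
  have hcont : Continuous fun t : ℝ => χ.LFunction (t : ℂ) :=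
    (DirichletCharacter.differentiable_LFunction hχ).continuous.comp continuous_ofReal
  have hclosed : IsClosed Z := by
    have : Z = Set.Icc β₀ 1 ∩ (fun t : ℝ => χ.LFunction (t : ℂ)) ⁻¹' {0} := by
      ext t; simp [hZ]
    rw [this]
    exact isClosed_Icc.inter (isClosed_singleton.preimage hcont)
  have hbdd : BddAbove Z := ⟨1, fun t ht => ht.1.2⟩
  have hne : Z.Nonempty := ⟨β₀, ⟨⟨le_rfl, hβ₀.le⟩, hz⟩⟩
  have hmem : sSup Z ∈ Z := hclosed.csSup_mem hne hbdd
  refine ⟨sSup Z, hmem.1.1, ?_, hmem.2, ?_⟩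
  · -- `sSup Z < 1` since `L(1, χ) ≠ 0`
    rcases lt_or_eq_of_le hmem.1.2 with hlt | heq
    · exact hlt
    · exfalso
      have h1 := hmem.2
      rw [heq, ofReal_one] at h1
      exact χ.LFunction_apply_one_ne_zero hχ h1
  · intro β' hlt hβ'1 hzero
    have : β' ∈ Z := ⟨⟨le_trans hmem.1.1 hlt.le, hβ'1.le⟩, hzero⟩
    exact absurd (le_csSup hbdd this) (not_le.mpr hlt)

/-- **Theorem 3 for every real zero** (not only the greatest): for `D ≥ D₀(ε)`, every primitive real
`χ` mod `D` and every real `β < 1` with `L(β, χ) = 0`: `(12/π − ε)/√D ≤ 1 − β`.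
[cite: Pintz1976ElementaryII, Theorem 3 p. 277 (1.24)] -/
theorem realZero_le_of_theorem3 (h : pintz1976_theorem3) {ε : ℝ} (hε : 0 < ε) :
    ∃ D₀ : ℕ, ∀ (D : ℕ) [NeZero D], D₀ ≤ D → ∀ χ : DirichletCharacter ℂ D, χ.IsQuadratic →
      χ.IsPrimitive → χ ≠ 1 → ∀ β : ℝ, β < 1 → χ.LFunction (β : ℂ) = 0 →
        (12 / Real.pi - ε) / Real.sqrt D ≤ 1 - β := by
  obtain ⟨D₀, hD₀⟩ := h ε hε
  refine ⟨D₀, fun D _ hD χ hquad hprim hχ β hβ1 hz => ?_⟩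
  obtain ⟨β₁, hle, hgr⟩ := exists_isGreatestRealZero hχ hβ1 hz
  have := hD₀ D hD χ hquad hprim β₁ hgr
  linarith

/-- For `q ≥ 3`, `1 < log q`. [folklore] -/
private theorem one_lt_log_of_three_le {q : ℕ} (hq : 3 ≤ q) : 1 < Real.log q := by
  have hq3 : (3 : ℝ) ≤ (q : ℝ) := by exact_mod_cast hq
  have hlog3 : 1 < Real.log 3 := by
    have h := Real.exp_one_lt_d9
    rw [Real.lt_log_iff_exp_lt (by norm_num)]
    linarith
  exact lt_of_lt_of_le hlog3 (Real.log_le_log (by norm_num) hq3)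

/-- **Theorem 3 in Tao–Teräväinen's vocabulary**: for `D ≥ max(D₀(ε), 3)`, a Siegel zero
`β = 1 − 1/(η log D)` of quality `η` (Definition 1.4) of a primitive quadratic character mod `D` has
`η ≤ √D/((12/π − ε) log D)` whenever `12/π − ε > 0` — the effective (inexplicit-threshold) cap,
to be compared with Ralaivaosaona–Razakarinoro's explicit `η < √q/(6.035 log q)` for odd `χ`,
`q > 3·10⁸` (`IsSiegelZero.quality_lt_of_theorem1`). [cite: Pintz1976ElementaryII, Theorem 3 p. 277]
[cite: TaoTeravainen2021, Definition 1.4] -/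
theorem IsSiegelZero.quality_le_of_theorem3 (h : pintz1976_theorem3) {ε : ℝ} (hε : 0 < ε)
    (hε' : 0 < 12 / Real.pi - ε) :
    ∃ D₀ : ℕ, ∀ (D : ℕ) [NeZero D], D₀ ≤ D → 3 ≤ D → ∀ (χ : DirichletCharacter ℂ D) (η : ℝ),
      Literature.Barriers.Parity.IsSiegelZero χ η →
        η ≤ Real.sqrt D / ((12 / Real.pi - ε) * Real.log D) := by
  obtain ⟨D₀, hD₀⟩ := realZero_le_of_theorem3 h hε
  refine ⟨D₀, fun D _ hD h3 χ η hS => ?_⟩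
  obtain ⟨hprim, hquad, h10, hz⟩ := hS
  have hlog : 1 < Real.log D := one_lt_log_of_three_le h3
  have hη : 0 < η := by linarith
  have hηlog : 0 < η * Real.log D := by positivity
  have hχ : χ ≠ 1 := by
    intro h1
    -- the trivial character mod `D ≥ 3` is not primitive
    have hcond : χ.conductor = D := hprim
    rw [h1, DirichletCharacter.conductor_one] at hcond
    omega
  have hβ1 : 1 - 1 / (η * Real.log D) < 1 := by
    have : 0 < 1 / (η * Real.log D) := by positivity
    linarith
  have hb := hD₀ D hD χ hquad hprim hχ _ hβ1 hz
  -- `(12/π − ε)/√D ≤ 1/(η log D)` ⟹ `η ≤ √D/((12/π − ε) log D)`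
  have hsqrt : 0 < Real.sqrt D := Real.sqrt_pos.mpr (by exact_mod_cast (show 0 < D by omega))
  have hb' : (12 / Real.pi - ε) / Real.sqrt D ≤ 1 / (η * Real.log D) := by linarith
  rw [div_le_div_iff₀ hsqrt hηlog] at hb'
  rw [le_div_iff₀ (by positivity)]
  nlinarith

end Pintz1976

end Literature.NumberTheory.LFunctions

end
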